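import Summits.QuantumFields.BalabanUV.T4Continuum.Support.NE7ConvOneStepSU2
import Summits.QuantumFields.BalabanUV.T4Continuum.Support.NE3ClassRadiusFamily
import HarnessLib

/-!
# NE7ConvOneStepSU3 — AT `d = 4`, `L = 2`, SU(3)∕U(3) (`card n = 3`), CLASS RADIUS `0 < ε ≤ 10⁻⁵³`: ONE-STEP ⇐ CRIT-ONE-STEP ∧ REP AND NOTHING ELSE —
# (P♮)_W from row NE3's lines `NE3ClassSlicePoincare.lines_d4_L2_c3` (+ the n-free `C2sq`∕`rho` line of `lines_d4_L2_c2`) through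
# `classSlicePoincare_of_lines`, the `LevelSmall` family by F12's `levelSmall_all_d4_L2`, all BY NAME

Cell `pub-balaban`, rung (B)+1 sub-cell t4, lineage `b2b-balaban-t4-ne7-p1`, generation 66 (CRUX PROVER NE7 #1); hunt (h10) «ONE-STEP = CRIT ∧ CONV»,
memo `t4/b2b-balaban-t4-ne7-p1-g66/HUNT-H10-TWO-ROADS.md` §2.  File F13 (over F12 `NE7ConvOneStepSU2` and F10 `NE7CriticalSliceAdapter`; the programme's case `d = 4`, three colours).

WHAT ([folklore] composition + two numerals; 0 def, 0 sorry).  **`oneStep_SU3_of_kerCritical_rep`** — `d = 4`, `L = 2`, `card n = 3`, `N ≥ 1`,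
`0 < ε ≤ 10⁻⁵³`: the ONE-STEP binder of `NE7InteriorInduction.interior_exists_all_levels` (hence (8)∃ and route 1's (A)-bill at curved data) holds for the
datum `V` as soon as, for every level `k` and every admissible competitor `U₀` of level `k+1` with `SmallField U₀ (δ(2^k)^{−2})`, there is an admissible `U♯`
with `SmallField U♯ (δ(2^{k+1})^{−2})` that is CRITICAL ON `ker (levelQ' 2 N k U♯)` ([Balaban1985Variational] Thm 1 + Prop. 7 + Sect. F's printed content,
LOCAL reading; by F8 ≡ the Euler–Lagrange system with a coarse multiplier) and over which every admissible `U′` is REPRESENTED (Prop. 2 TYPE: gauge-fixed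
`X` with `‖X‖_∞ ≤ α`, `levelAction (U♯e^X) ≤ levelAction U′`, `SmallField (U♯e^X) (ε(2^{k+1})^{−2})`, split `X = X_T + X_N`, `X_T ∈ T_♮(U♯)`, `X_N`
skew periodic, normal letters `θ_N`, `C_N`) under the numeric line of F4 with the CONSTANT OF RECORD `CP = CPLine 4 2 3 10⁻¹⁷ 10⁻⁵³ + 1` (row NE3-R2's
K-road constant, k-free).  NO Poincaré hypothesis, NO level-smallness hypothesis, NO K-road line remains: they are row NE3's theorems
`NE3ClassSlicePoincare.classSlicePoincare_of_lines` + `lines_d4_L2_c3` ∕ `lines_d4_L2_c2` (assembled here as **`classSlicePoincare_SU3`**) and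
F12's `levelSmall_all_d4_L2`.
SO, FOR THE PROGRAMME's CASE: ONE-STEP ⇐ [kernel] CRIT-ONE-STEP ∧ REP.  HONEST FRAMING (page 1): composition over the two HYPOTHESES CRIT and REP
(neither proved; CRIT = B11 Sects. B–E over [5] = B9; REP = B8 Thm 2 ∕ B11 Prop. 2 TYPE with route-Π-type normal sizes); NOT ONE-STEP, NOT NE7; spine 0∕9;
finite T⁴ rung (B)+1 — NOT infinite volume, NOT mass gap, NOT Clay.  Continuum YM on T⁴ ⇐ BetaPertH ∧ nine spine estimates (0/9 proved); BetaPertH ⇐ (D1) ∧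
(D4) ∧ CAP+tail; G-an2-4 gates asym, D1 and NE2/3/4.
-/

set_option autoImplicit false

open scoped BigOperators Matrix.Norms.L2Operator
open NormedSpace Finset Set

namespace Summit.QuantumFields.BalabanUV.T4Continuum.NE7ConvOneStepSU3

open Literature.MathematicalPhysics.QuantumFieldTheory.Balaban1983to89
open B7Prop1Explicit B7Prop2Explicit MatrixLog UnitaryModel
open T4AveragingDeficitWall (IsUnitaryCfg IsSkewDir SmallField fineAction vary curl curlSq dirSq)
open T4AveragingDeficitWallBoundary (IsPeriodicCfg periodBox)
open AveragingDeficitPeriodicCounting (IsPeriodicDir)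
open AveragingDeficitTorusChart (TDir extDir)
open AveragingDeficitTwoLevelPrep (twoLevelSmall)
open AveragingDeficitMultiLevelPrep (tower LevelSmall levelQ')
open MinimalActionLevels (levelAction perWin)
open MinimalActionSandwich (IsMinimiser admissible)
open MinimalActionRate (sfClass)
open NE3HessForm (dAction)
open NE3SlicePoincareShape (SlicePoincare slicePoincare_mono)
open NE3FrameFreeSliceW (frameFreeBlockLandauW)
open NE3SlicePoincareBudgetLine (CPLine)
open NE3ClassSlicePoincare (classSlicePoincare_of_lines lines_d4_L2_c2 lines_d4_L2_c3)
open NE3ClassRadiusFamily (CPLine_nonneg levelSmall_family_d4_L2)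
open NE7CriticalSliceAdapter (oneStep_of_kerCritical_rep_class)
open NE7ConvOneStepSU2 (levelSmall_all_d4_L2)

noncomputable section

variable {n : Type*} [Fintype n] [DecidableEq n]

/-- **(P♮)_W ON THE CLASS AT `d = 4`, `L = 2`, `card n = 3`, NO NUMERIC HYPOTHESIS BUT `0 < ε ≤ 10⁻⁵³`** (row NE3's `classSlicePoincare_of_lines` with
`lines_d4_L2_c3` and the n-free `C2sq`∕`rho` line of `lines_d4_L2_c2`; the family by `levelSmall_family_d4_L2`; constant `CPLine 4 2 3 10⁻¹⁷ 10⁻⁵³ ≤ 2776·10¹⁴`).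
[folklore] -/
theorem classSlicePoincare_SU3 [Nonempty n] (hn : Fintype.card n = 3) {N : ℕ} (hN : 1 ≤ N) {ε : ℝ} (hε : 0 < ε) (hε' : ε ≤ 1 / 10 ^ 53) :
    ∀ j : ℕ, ∀ W : Site 4 → Fin 4 → (Matrix n n ℂ)ˣ, W ∈ sfClass 4 2 N ε (j + 1) →
      SlicePoincare 2 (j + 1) W (frameFreeBlockLandauW 2 N (j + 1) W) (CPLine 4 2 3 (1 / 10 ^ 17) (1 / 10 ^ 53))
        (periodBox (N * 2 ^ (j + 1))) := by
  obtain ⟨h1, h2, h4, -⟩ := lines_d4_L2_c3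
  obtain ⟨-, -, h3, -, -⟩ := lines_d4_L2_c2
  have hsmall := levelSmall_family_d4_L2 hε.le (hε'.trans (by norm_num))
  have h := classSlicePoincare_of_lines (n := n) (d := 4) (L := 2) (by norm_num) (by norm_num) hN hε hε'
    (by norm_num : (0 : ℝ) < 1 / 10 ^ 17) hsmall
  rw [hn] at h
  exact h h1 h2 h3 h4

/-- **ONE-STEP AT `d = 4`, `L = 2`, SU(3)∕U(3), `0 < ε ≤ 10⁻⁵³`, FROM CRIT-ONE-STEP ON `ker levelQ'` AND REP ONLY.**  See the module docstring. [folklore] -/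
theorem oneStep_SU3_of_kerCritical_rep [Nonempty n] (hn : Fintype.card n = 3) {N : ℕ} [NeZero N] (hN : 1 ≤ N) {ε δ : ℝ} (hε : 0 < ε)
    (hε' : ε ≤ 1 / 10 ^ 53) {V : Site 4 → Fin 4 → (Matrix n n ℂ)ˣ}
    (hcrit : ∀ (k : ℕ) (U₀ : Site 4 → Fin 4 → (Matrix n n ℂ)ˣ), U₀ ∈ admissible (sfClass 4 2 N ε) 2 (k + 1) V →
      SmallField U₀ (δ / (((2 : ℕ) : ℝ) ^ k) ^ 2) →
      ∃ Us : Site 4 → Fin 4 → (Matrix n n ℂ)ˣ, Us ∈ admissible (sfClass 4 2 N ε) 2 (k + 1) V ∧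
        SmallField Us (δ / (((2 : ℕ) : ℝ) ^ (k + 1)) ^ 2) ∧
        (∀ Φ : TDir 4 n (2 * tower 2 N k), (∀ r κ, Φ r κ ∈ skewAdjoint (Matrix n n ℂ)) →
          levelQ' 2 N k Us Φ = 0 → dAction Us (extDir (2 * tower 2 N k) Φ) (perWin 4 (N * 2 ^ (k + 1))) = 0) ∧
        ∀ U' ∈ admissible (sfClass 4 2 N ε) 2 (k + 1) V, ∃ (X XT XN : Site 4 → Fin 4 → Matrix n n ℂ) (α θN CN : ℝ),
          IsSkewDir X ∧ IsPeriodicDir X ((N * 2 ^ (k + 1) : ℕ) : ℤ) ∧ 0 ≤ α ∧ (∀ x μ, ‖X x μ‖ ≤ α) ∧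
          levelAction 4 2 N (k + 1) (vary Us X 1) ≤ levelAction 4 2 N (k + 1) U' ∧
          SmallField (vary Us X 1) (ε / (((2 : ℕ) : ℝ) ^ (k + 1)) ^ 2) ∧
          X = XT + XN ∧ XT ∈ frameFreeBlockLandauW (d := 4) (n := n) 2 N (k + 1) Us ∧ IsSkewDir XN ∧
          IsPeriodicDir XN ((N * 2 ^ (k + 1) : ℕ) : ℤ) ∧
          dirSq XN (periodBox (d := 4) (N * 2 ^ (k + 1))) ≤ θN * dirSq X (periodBox (d := 4) (N * 2 ^ (k + 1))) ∧
          (∑ p ∈ perWin 4 (N * 2 ^ (k + 1)), ‖curl Us XN p‖) ≤ CN * dirSq X (periodBox (d := 4) (N * 2 ^ (k + 1))) ∧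
          2 * (ε / (((2 : ℕ) : ℝ) ^ (k + 1)) ^ 2 * CN)
            ≤ ((((((((2 : ℕ) : ℝ) ^ (k + 1))⁻¹) ^ 2 / (CPLine 4 2 3 (1 / 10 ^ 17) (1 / 10 ^ 53) + 1)) / 4
                - ((((((2 : ℕ) : ℝ) ^ (k + 1))⁻¹) ^ 2 / (CPLine 4 2 3 (1 / 10 ^ 17) (1 / 10 ^ 53) + 1)) / 2 + 16 * (4 : ℕ)) * θN) / 2
                - 576 * (4 : ℕ) * (Real.exp α - 1) ^ 2) / (Fintype.card n : ℝ)
              - 28 * (4 : ℕ) * (ε / (((2 : ℕ) : ℝ) ^ (k + 1)) ^ 2 + 7 * α ^ 2))) :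
    ∀ (k : ℕ) (U₀ : Site 4 → Fin 4 → (Matrix n n ℂ)ˣ), U₀ ∈ admissible (sfClass 4 2 N ε) 2 (k + 1) V →
      SmallField U₀ (δ / (((2 : ℕ) : ℝ) ^ k) ^ 2) →
      ∃ U, IsMinimiser 4 (sfClass 4 2 N ε) 2 N (k + 1) V U ∧ SmallField U (δ / (((2 : ℕ) : ℝ) ^ (k + 1)) ^ 2) := by
  have hP0 := classSlicePoincare_SU3 (n := n) hn hN hε hε'
  have hCP0 : 0 ≤ CPLine 4 2 3 (1 / 10 ^ 17) (1 / 10 ^ 53) := CPLine_nonneg (by norm_num) (by norm_num) (by norm_num) (by norm_num)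
  have hCP : 0 < CPLine 4 2 3 (1 / 10 ^ 17) (1 / 10 ^ 53) + 1 := by linarith
  have hP : ∀ (j : ℕ) (W : Site 4 → Fin 4 → (Matrix n n ℂ)ˣ), W ∈ sfClass 4 2 N ε (j + 1) →
      SlicePoincare 2 (j + 1) W (frameFreeBlockLandauW 2 N (j + 1) W) (CPLine 4 2 3 (1 / 10 ^ 17) (1 / 10 ^ 53) + 1)
        (periodBox (d := 4) (N * 2 ^ (j + 1))) :=
    fun j W hW => slicePoincare_mono (hP0 j W hW) (by linarith)
  have hls := levelSmall_all_d4_L2 hε.le (hε'.trans (by norm_num))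
  exact oneStep_of_kerCritical_rep_class (d := 4) (by norm_num) hN hε.le hCP hls hP hcrit

end

end Summit.QuantumFields.BalabanUV.T4Continuum.NE7ConvOneStepSU3
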